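import Summits.BirchSwinnertonDyer.BirchSwinnertonDyer.Theorems.SchneiderFreeAdditiveX3AnticyclotomicTorsionLayers
import Literature.NumberTheory.EllipticCurves.SelmerPInftyRestriction
import Literature.NumberTheory.EllipticCurves.WeilPairingProofs
import Literature.NumberTheory.EllipticCurves.TateModuleProofs
import Literature.NumberTheory.EllipticCurves.GaloisActionProofs
import Literature.NumberTheory.GaloisRepresentations.ImaginaryQuadraticCyclotomicProofs
import Literature.NumberTheory.GaloisRepresentations.ModPGaloisRep
import HarnessLib

/-!
# Torsion in the anticyclotomic tower, II: `E(K_∞^{ac})[p^∞] = E(K)[p^∞]`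

Seat `bsd-schneider-door-c5` (cell `bsd-schneider-ideate`), gen 4; route `SchneiderFreeAdditiveX3`, crux
`AnticycControlAdditiveK` (stmt-BirchSwinnertonDyer-19295, skeleton v3-K). The registered stub
`stub_kerRes` asks for `#ker(H¹(K, E[p^∞]) → H¹(K_∞, E[p^∞])) = p^g`; door-c4's identification
`natCard_ker_resOfLe_top_eq_natCard_fixedPoints` (`…TorsionExponents.lean`) reduces it to the finiteness
of `B = E(K_∞)[p^∞] = E[p^∞]^{Gal(K̄/K_∞)}`, kept there as a HYPOTHESIS ("standard … not a tree
theorem"; Greenberg LNM 1716 §1 p. 62; the tree has it for the cyclotomic tower at good ordinary `p`,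
`IwasawaTowerTorsionOrdinaryProofs`, and whenever `E(K)[p] = 0`, `IwasawaTowerTorsionProofs`). This
file PROVES it on the anticyclotomic tower, in the sharp form **`E(K_∞^{ac})[p^∞] = E(K)[p^∞]`** for
every elliptic curve `E/ℚ`, odd prime `p`, imaginary quadratic `K` with `μ_p(K) = 1`, and
anticyclotomic `ℤ_p`-extension `κ` of `K` (`smul_eq_of_mem_fixedPoints_kerSubgroup_of_isAnticyclotomic`,
`mem_fixedPoints_kerSubgroup_iff_of_isAnticyclotomic`), whence `[Finite B]`
(`finite_fixedPoints_kerSubgroup_of_isAnticyclotomic`; `…_of_not_dvd_torsionOrder` under the route's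
`p ∤ #μ(K)`) and `#B = #E(K)[p^∞]`. No reduction hypothesis at any prime, no cite-only fact.

Proof (continuing `…AnticyclotomicTorsionLayers.lean`, §§1–4): over `ℚ̄`, with `N = res(ker κ)`
normal in `Γ_ℚ` and `B = E[p^∞]^N` `Γ_ℚ`-stable, either `E[p] ⊄ B` — then `#B[p] ≤ p`, every layer
`B[p^n]` is cyclic, and `Γ_K` acts trivially on it (Case A: dihedral relation + `p`-power order, `p`
odd) — or `E[p] ⊆ B`, and the Weil pairing (`exists_weilPairing_holds`) yields `ζ_p ≠ 1` fixed by
`N`, so the mod-`p` cyclotomic character of `Γ_K` kills `ker κ` and has `p`-group image in `(ℤ/p)ˣ`,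
i.e. is trivial: `ζ_p` is `Γ_K`-fixed, hence in `K` (`Rat.exists_eq_of_forall_range_absGaloisRestrict_smul`),
excluded (Case B, `false_of_forall_pTorsion_kerSubgroup_smul_eq`). §5 transports to `E_K[p^∞](K̄)`
along the equivariant `primaryBaseChangeEquiv`.

Proofs only (no definition, no named fact, no `sorry`); closes nothing by itself; BSD is not
advanced beyond discharging the hypothesis `[Finite E(K_∞^{ac})[p^∞]]` of the control-theorem counts
(Greenberg's Lemma 4.3 / Thm. 4.1 shape; the (KER-res) atom of crux 19295).

## References

* [GreenbergLNM1716] R. Greenberg, *Iwasawa theory for elliptic curves*, LNM 1716 (1999), §1 p. 62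
  ("The crucial step is to show that `E(F_∞)_{tors}` is finite"), §3 Lemma 3.1 (p. 86), §4 Lemma 4.3.
* [Brink2007] D. Brink, Math. Comp. 76 (2007), §II Prop. 1 (`K^{anti}` pro-dihedral over `ℚ`).
* [SilvermanAEC2009] J. H. Silverman, *The Arithmetic of Elliptic Curves*, III.§8, Cor. III.6.4.
-/

noncomputable section

open scoped Classical

namespace Summit.BirchSwinnertonDyer.BirchSwinnertonDyer.Theorems.SchneiderFreeAdditiveX3

open WeierstrassCurve Field Literature.NumberTheory.EllipticCurves
  Literature.NumberTheory.GaloisRepresentations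

set_option linter.dupNamespace false

/-! ## §4 (continued). Over `ℚ̄`: Case B (Weil pairing) and the main theorem -/

section Rational

variable (W : WeierstrassCurve ℚ) [W.IsElliptic] {p : ℕ} [hp : Fact p.Prime]
  {K : Type} [Field K] [NumberField K] (κ : ZpExtension K p)

/-- **Case B (the Weil pairing).** If every `p`-torsion point of `E(ℚ̄)` is fixed by `res(ker κ)`
then — `ζ_p = e_p(S, T)` for a non-degenerate pair — a primitive `p`-th root of unity is fixed by
`res(ker κ)`, so the mod-`p` cyclotomic character of `Γ_K` factors through a finite quotient of
`Γ_K/ker κ ≅ ℤ_p`: a `p`-group inside `(ℤ/p)ˣ`, hence trivial; so `ζ_p` is fixed by `Γ_K` and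
lies in `K`. Impossible when `K` has no non-trivial `p`-th root of unity. [folklore] -/
theorem false_of_forall_pTorsion_kerSubgroup_smul_eq (hζ : ∀ z : K, z ^ p = 1 → z = 1)
    (hB : ∀ Q : geomPoints W, p • Q = 0 →
      ∀ τ ∈ κ.kerSubgroup, absGaloisRestrict ℚ K τ • Q = Q) : False := by
  have hprime : p.Prime := hp.out
  have hp2' : 2 ≤ p := hprime.two_le
  have hpQ : (p : ℚ) ≠ 0 := by exact_mod_cast hprime.ne_zero
  obtain ⟨e, hpow, -, -, -, hnondeg, hgal⟩ := exists_weilPairing_holds W p hp2' hpQ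
  -- a non-zero `p`-torsion point `T` and a partner `S` with `e S T ≠ 1`
  have hpZ : ((p : ℕ) : ℤ) ≠ 0 := by exact_mod_cast hprime.ne_zero
  haveI : Finite (geomTorsion W ((p : ℕ) : ℤ)) :=
    finite_torsionPoints_holds W (AlgebraicClosure ℚ) hpZ
  have hcard : Nat.card (geomTorsion W ((p : ℕ) : ℤ)) = p ^ 2 := by
    have hpQbar : ((p : ℕ) : AlgebraicClosure ℚ) ≠ 0 := Nat.cast_ne_zero.mpr hprime.ne_zero
    exact card_torsionPoints_eq_sq_holds W (AlgebraicClosure ℚ) hpQbar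
  have hnt : Nontrivial (geomTorsion W ((p : ℕ) : ℤ)) := by
    rw [← Finite.one_lt_card_iff_nontrivial, hcard]
    exact Nat.one_lt_pow two_ne_zero hprime.one_lt
  obtain ⟨T, hT⟩ := exists_ne (0 : geomTorsion W ((p : ℕ) : ℤ))
  obtain ⟨S, hS⟩ : ∃ S, e S T ≠ 1 := by
    by_contra h
    push Not at h
    exact hT (hnondeg T h)
  have hζp : e S T ^ p = 1 := hpow S T
  -- `res(ker κ)` fixes `S` and `T`, hence `ζ = e S T`
  have htors : ∀ R : geomTorsion W ((p : ℕ) : ℤ), p • (R : geomPoints W) = 0 := fun R ↦ by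
    rw [← natCast_zsmul]; exact (mem_torsionPoints_iff _ _ _).mp R.2
  have hfixζ : ∀ τ ∈ κ.kerSubgroup, absGaloisRestrict ℚ K τ • e S T = e S T := by
    intro τ hτ
    have hS' : absGaloisRestrict ℚ K τ • S = S := Subtype.ext (by
      rw [Literature.NumberTheory.EllipticCurves.AddSubgroup.torsionBy.coe_smul]
      exact hB _ (htors S) τ hτ)
    have hT' : absGaloisRestrict ℚ K τ • T = T := Subtype.ext (by
      rw [Literature.NumberTheory.EllipticCurves.AddSubgroup.torsionBy.coe_smul]
      exact hB _ (htors T) τ hτ)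
    rw [hgal, hS', hT']
  -- the mod-`p` cyclotomic character and its triviality on elements fixing `ζ`
  haveI : NeZero ((p : ℕ) : ℚ) := ⟨hpQ⟩
  have hordζ : orderOf (e S T) = p := orderOf_eq_prime hζp hS
  have hχ1 : ∀ g : absoluteGaloisGroup ℚ, g • e S T = e S T →
      modPCyclotomicCharacterZMod ℚ p g = 1 := by
    intro g hg
    have hspec := modPCyclotomicCharacterZMod_spec ℚ p g (e S T) hζp
    rw [hg] at hspec
    have hv : ((modPCyclotomicCharacterZMod ℚ p g : ZMod p)).val = 1 := by
      set v := ((modPCyclotomicCharacterZMod ℚ p g : ZMod p)).val with hv_def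
      have hv0 : v ≠ 0 := by
        intro h0
        rw [h0, pow_zero] at hspec
        exact hS hspec
      have hζ0 : e S T ≠ 0 := fun h0 ↦ by
        rw [h0, zero_pow hprime.ne_zero] at hζp
        exact zero_ne_one hζp
      have h1 : e S T ^ (v - 1) = 1 := by
        have h : e S T ^ (v - 1) * e S T = 1 * e S T := by
          rw [← pow_succ, Nat.sub_add_cancel (Nat.one_le_iff_ne_zero.mpr hv0), one_mul]
          exact hspec.symm
        exact mul_right_cancel₀ hζ0 h
      have hdvd : p ∣ v - 1 := hordζ ▸ orderOf_dvd_of_pow_eq_one h1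
      have hlt : v - 1 < p := lt_of_le_of_lt (Nat.sub_le v 1) (ZMod.val_lt _)
      have h0 : v - 1 = 0 := Nat.eq_zero_of_dvd_of_lt hdvd hlt
      omega
    refine Units.ext (ZMod.val_injective p ?_)
    rw [hv, Units.val_one, ZMod.val_one]
  -- `χ̄_p ∘ res` kills `ker κ`, so its image is a `p`-group inside `(ℤ/p)ˣ`: trivial
  haveI : NeZero p := ⟨hprime.ne_zero⟩
  let φ : absoluteGaloisGroup K →* (ZMod p)ˣ :=
    (modPCyclotomicCharacterZMod ℚ p).comp (absGaloisRestrict ℚ K).toMonoidHom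
  have hφ : ∀ σ, φ σ = modPCyclotomicCharacterZMod ℚ p (absGaloisRestrict ℚ K σ) := fun _ ↦ rfl
  let ρ' : absoluteGaloisGroup K →* Equiv.Perm (ZMod p)ˣ :=
    (MulAction.toPermHom (ZMod p)ˣ (ZMod p)ˣ).comp φ
  have hρ' : ∀ σ (x : (ZMod p)ˣ), ρ' σ x = φ σ * x := fun _ _ ↦ rfl
  have hker : κ.kerSubgroup ≤ ρ'.ker := by
    intro τ hτ
    rw [MonoidHom.mem_ker]
    refine Equiv.ext fun x ↦ ?_
    rw [hρ', hφ, hχ1 _ (hfixζ τ hτ), one_mul, Equiv.Perm.coe_one, id_eq]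
  have hPgrp : IsPGroup p ρ'.range := κ.isPGroup_range_of_kerSubgroup_le ρ' hker
  have hcop : Nat.Coprime p (p - 1) := by
    have h := Nat.coprime_self_add_left (m := p - 1) (n := 1)
    rw [Nat.sub_add_cancel hprime.one_le] at h
    exact h.mpr (Nat.coprime_one_left _)
  have hφ1 : ∀ σ, φ σ = 1 := by
    intro σ
    obtain ⟨k, hk⟩ := hPgrp ⟨ρ' σ, ⟨σ, rfl⟩⟩
    have hk' : ρ' (σ ^ p ^ k) = 1 := by
      rw [map_pow]
      have := congrArg Subtype.val hk
      simpa using this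
    have h1 : φ σ ^ p ^ k = 1 := by
      have h := congrArg (fun f : Equiv.Perm (ZMod p)ˣ ↦ f 1) hk'
      simp only [hρ', Equiv.Perm.coe_one, id_eq, mul_one] at h
      rw [map_pow] at h
      exact h
    have h2 : φ σ ^ (p - 1) = 1 := ZMod.units_pow_card_sub_one_eq_one p (φ σ)
    exact (pow_eq_one_iff_of_coprime (hcop.pow_left k)).mp ⟨h1, h2⟩
  -- hence `Γ_K` fixes `ζ`, which therefore comes from `K`
  have hfixK : ∀ g ∈ ((absGaloisRestrict ℚ K).range : Subgroup (absoluteGaloisGroup ℚ)),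
      g • e S T = e S T := by
    rintro _ ⟨σ, rfl⟩
    have hspec := modPCyclotomicCharacterZMod_spec ℚ p (absGaloisRestrict ℚ K σ) (e S T) hζp
    rw [← hφ, hφ1, Units.val_one, ZMod.val_one, pow_one] at hspec
    exact hspec
  obtain ⟨emb, z, hz⟩ := Rat.exists_eq_of_forall_range_absGaloisRestrict_smul K hfixK
  have hzp : z ^ p = 1 := by
    apply (emb : K →+* AlgebraicClosure ℚ).injective
    rw [map_pow, map_one]
    change emb z ^ p = 1
    rw [hz]; exact hζp
  apply hS
  rw [← hz, hζ z hzp, map_one]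

/-- **Over `ℚ̄`: `E[p^∞]^{Gal(ℚ̄/K_∞^{ac})} = E[p^∞]^{Γ_K}`.** For `E/ℚ`, `p` odd, `K` imaginary
quadratic without non-trivial `p`-th roots of unity and `κ` an anticyclotomic `ℤ_p`-extension of
`K`: a `p`-power torsion point of `E(ℚ̄)` fixed by `res τ` for all `τ ∈ ker κ = Gal(K̄/K_∞)` is
fixed by `res σ` for all `σ ∈ Γ_K`. Proof: let `B` be the (`Γ_ℚ`-stable) group of such points.
Either `E[p] ⊆ B`, excluded by `false_of_forall_pTorsion_kerSubgroup_smul_eq` (Weil pairing), or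
`#B[p] ≤ p`, and then every layer `B[p^n]` is cyclic (`isAddCyclic_layer`) and `Γ_K` acts
trivially on it (`absGaloisRestrict_smul_eq_of_isAddCyclic`). [folklore] -/
theorem absGaloisRestrict_smul_eq_of_forall_kerSubgroup_smul_eq (hp2 : p ≠ 2)
    (hK : IsImaginaryQuadratic K) (hζ : ∀ z : K, z ^ p = 1 → z = 1) (hκ : κ.IsAnticyclotomic)
    {P : geomPoints W} (hPprim : ∃ n : ℕ, p ^ n • P = 0)
    (hPfix : ∀ τ ∈ κ.kerSubgroup, absGaloisRestrict ℚ K τ • P = P)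
    (σ : absoluteGaloisGroup K) : absGaloisRestrict ℚ K σ • P = P := by
  have hprime : p.Prime := hp.out
  by_cases hcase : ∀ Q : geomPoints W, p • Q = 0 →
      ∀ τ ∈ κ.kerSubgroup, absGaloisRestrict ℚ K τ • Q = Q
  · exact (false_of_forall_pTorsion_kerSubgroup_smul_eq W κ hζ hcase).elim
  push Not at hcase
  obtain ⟨Q₀, hQ₀p, τ₀, hτ₀, hQ₀⟩ := hcase
  -- `B' = E[p^∞]^{res(ker κ)}` and its layers `V n = B'[p^n]`
  let N' : Subgroup (absoluteGaloisGroup ℚ) :=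
    κ.kerSubgroup.map (absGaloisRestrict ℚ K).toMonoidHom
  let B' : AddSubgroup (geomPoints W) :=
    W.geomPrimaryTorsion p ⊓ FixedPoints.addSubgroup N' (geomPoints W)
  have hmemB' : ∀ Q, Q ∈ B' ↔
      (∃ n : ℕ, p ^ n • Q = 0) ∧ ∀ τ ∈ κ.kerSubgroup, absGaloisRestrict ℚ K τ • Q = Q := by
    intro Q
    change Q ∈ W.geomPrimaryTorsion p ⊓ FixedPoints.addSubgroup N' (geomPoints W) ↔ _
    rw [AddSubgroup.mem_inf, FixedPoints.mem_addSubgroup]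
    constructor
    · rintro ⟨h1, h2⟩
      refine ⟨(AddCommGroup.mem_primaryComponent).mp h1, fun τ hτ ↦ ?_⟩
      have h := h2 ⟨absGaloisRestrict ℚ K τ, Subgroup.mem_map.mpr ⟨τ, hτ, rfl⟩⟩
      rwa [Subgroup.mk_smul] at h
    · rintro ⟨h1, h2⟩
      refine ⟨(AddCommGroup.mem_primaryComponent).mpr h1, ?_⟩
      rintro ⟨g, hg⟩
      obtain ⟨τ, hτ, rfl⟩ := Subgroup.mem_map.mp hg
      rw [Subgroup.mk_smul]
      exact h2 τ hτ
  let V : ℕ → AddSubgroup (geomPoints W) := fun n ↦ B' ⊓ geomTorsion W ((p ^ n : ℕ) : ℤ)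
  have hV : ∀ n Q, Q ∈ V n ↔ Q ∈ B' ∧ p ^ n • Q = 0 := by
    intro n Q
    change Q ∈ B' ⊓ geomTorsion W ((p ^ n : ℕ) : ℤ) ↔ _
    rw [AddSubgroup.mem_inf]
    have h := mem_torsionPoints_iff W (AlgebraicClosure ℚ) (n := ((p ^ n : ℕ) : ℤ)) Q
    rw [natCast_zsmul] at h
    exact and_congr Iff.rfl h
  have hfinT : ∀ n, Finite (geomTorsion W ((p ^ n : ℕ) : ℤ)) := fun n ↦
    finite_torsionPoints_holds W (AlgebraicClosure ℚ)
      (by exact_mod_cast pow_ne_zero n hprime.ne_zero)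
  have hfin : ∀ n, Finite (V n) := fun n ↦ by
    haveI := hfinT n
    exact Finite.of_injective _
      (AddSubgroup.inclusion_injective (inf_le_right : V n ≤ geomTorsion W ((p ^ n : ℕ) : ℤ)))
  -- stability under `Γ_ℚ` and pointwise fixing by `res(ker κ)`
  have hB'stab : ∀ g : absoluteGaloisGroup ℚ, ∀ Q ∈ B', g • Q ∈ B' := by
    intro g Q hQ
    rw [hmemB'] at hQ ⊢
    obtain ⟨⟨n, hn⟩, hfixQ⟩ := hQ
    exact ⟨⟨n, by rw [smul_comm, hn, smul_zero]⟩,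
      forall_kerSubgroup_smul_smul_eq W κ hK.1 hκ g hfixQ⟩
  have hVstab : ∀ n, ∀ g : absoluteGaloisGroup ℚ, ∀ Q ∈ V n, g • Q ∈ V n := by
    intro n g Q hQ
    rw [hV] at hQ ⊢
    exact ⟨hB'stab g Q hQ.1, by rw [smul_comm, hQ.2, smul_zero]⟩
  have hVfix : ∀ n, ∀ τ ∈ κ.kerSubgroup, ∀ Q ∈ V n, absGaloisRestrict ℚ K τ • Q = Q :=
    fun n τ hτ Q hQ ↦ ((hmemB' Q).mp ((hV n Q).mp hQ).1).2 τ hτ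
  -- `#V 1 ≤ p`: `V 1` is a proper subgroup of `E[p]`, which has `p²` elements
  have h1 : Nat.card (V 1) ≤ p := by
    haveI := hfinT 1
    have hpQ : (p : ℚ) ≠ 0 := by exact_mod_cast hprime.ne_zero
    have hcardT : Nat.card (geomTorsion W ((p ^ 1 : ℕ) : ℤ)) = p ^ 2 := by
      have h := card_geomTorsion_pow_eq W p (card_torsionPoints_eq_sq_holds W (AlgebraicClosure ℚ))
        hpQ 1
      rwa [mul_one] at h
    have hle : V 1 ≤ geomTorsion W ((p ^ 1 : ℕ) : ℤ) := inf_le_right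
    have hne : V 1 ≠ geomTorsion W ((p ^ 1 : ℕ) : ℤ) := by
      intro heq
      have hQ₀V : Q₀ ∈ V 1 := by
        rw [heq]
        refine (mem_torsionPoints_iff W (AlgebraicClosure ℚ) Q₀).mpr ?_
        rw [natCast_zsmul, pow_one]
        exact hQ₀p
      exact hQ₀ (hVfix 1 τ₀ hτ₀ Q₀ hQ₀V)
    have hdvd : Nat.card (V 1) ∣ p ^ 2 := hcardT ▸ AddSubgroup.card_dvd_of_le hle
    obtain ⟨i, hi, hci⟩ := (Nat.dvd_prime_pow hprime).mp hdvd
    have hi1 : i ≤ 1 := by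
      by_contra hgt
      have hi2 : i = 2 := le_antisymm hi (by omega)
      exact hne (AddSubgroup.eq_of_le_of_card_ge hle (by rw [hci, hi2, hcardT]))
    rw [hci]
    calc p ^ i ≤ p ^ 1 := Nat.pow_le_pow_right hprime.pos hi1
      _ = p := pow_one p
  -- the layer containing `P` is cyclic, and `Γ_K` acts trivially on it
  obtain ⟨n, hn⟩ := hPprim
  haveI := hfin n
  haveI : IsAddCyclic (V n) := isAddCyclic_layer hV hfin h1 n
  have hPV : P ∈ V n := (hV n P).mpr ⟨(hmemB' P).mpr ⟨⟨n, hn⟩, hPfix⟩, hn⟩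
  exact absGaloisRestrict_smul_eq_of_isAddCyclic W κ hp2 hK hκ (V n) (hVstab n) (hVfix n) σ hPV

end Rational

/-! ## §5. Over `K`: `E(K_∞^{ac})[p^∞] = E(K)[p^∞]`, finiteness -/

section OverK

variable (W : WeierstrassCurve ℚ) [W.IsElliptic] (p : ℕ) [hp : Fact p.Prime]
  {K : Type} [Field K] [NumberField K] (κ : ZpExtension K p)

omit [NumberField K] in
/-- A number field whose unit torsion order is prime to `p` has no non-trivial `p`-th root of
unity (Mathlib `NumberField.Units.rootsOfUnity_eq_one`). [folklore] -/
theorem eq_one_of_pow_prime_eq_one_of_not_dvd_torsionOrder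
    (hpK : ¬ p ∣ NumberField.Units.torsionOrder K) (z : K) (hz : z ^ p = 1) : z = 1 := by
  have hprime : p.Prime := hp.out
  have hint : IsIntegral ℤ z := IsIntegral.of_pow hprime.pos (by rw [hz]; exact isIntegral_one)
  set x : NumberField.RingOfIntegers K := ⟨z, hint⟩ with hx
  have hxp : x ^ p = 1 := by
    apply NumberField.RingOfIntegers.coe_injective
    rw [map_pow, map_one]
    exact hz
  have hu : IsUnit x := IsUnit.of_pow_eq_one hxp hprime.ne_zero
  let k : ℕ+ := ⟨p, hprime.pos⟩
  have hζ : hu.unit ∈ rootsOfUnity (k : ℕ) (NumberField.RingOfIntegers K) := by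
    rw [mem_rootsOfUnity]
    apply Units.ext
    rw [Units.val_pow_eq_pow_val, IsUnit.unit_spec, Units.val_one]
    exact hxp
  have hcop : Nat.Coprime (k : ℕ) (NumberField.Units.torsionOrder K) :=
    (Nat.Prime.coprime_iff_not_dvd hprime).mpr hpK
  have h1 : hu.unit = 1 := (NumberField.Units.rootsOfUnity_eq_one K hcop).mp hζ
  have hx1 : x = 1 := by rw [← hu.unit_spec, h1, Units.val_one]
  have := congrArg (fun y : NumberField.RingOfIntegers K ↦ (y : K)) hx1
  simpa [hx] using this

/-- **`E(K_∞^{ac})[p^∞] = E(K)[p^∞]`.** For an elliptic curve `E/ℚ`, an odd prime `p`, an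
imaginary quadratic field `K` with no non-trivial `p`-th root of unity, and an anticyclotomic
`ℤ_p`-extension `κ` of `K` (`K_∞ = K̄^{ker κ}`): every point of `E[p^∞]^{Gal(K̄/K_∞)} = E(K_∞)[p^∞]`
is fixed by all of `Γ_K`, i.e. is `K`-rational. Transport of
`absGaloisRestrict_smul_eq_of_forall_kerSubgroup_smul_eq` along the equivariant identification
`E[p^∞](ℚ̄) ≃ E_K[p^∞](K̄)` (`primaryBaseChangeEquiv`). [folklore] -/
theorem smul_eq_of_mem_fixedPoints_kerSubgroup_of_isAnticyclotomic (hp2 : p ≠ 2)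
    (hK : IsImaginaryQuadratic K) (hζ : ∀ z : K, z ^ p = 1 → z = 1) (hκ : κ.IsAnticyclotomic)
    {m : geomPrimaryTorsion (W.baseChange K) p}
    (hm : m ∈ FixedPoints.addSubgroup κ.kerSubgroup (geomPrimaryTorsion (W.baseChange K) p))
    (σ : absoluteGaloisGroup K) : σ • m = m := by
  let e := primaryBaseChangeEquiv K W p
  set P := e.symm m with hP
  have hmP : m = e P := (e.apply_symm_apply m).symm
  have hequiv : ∀ τ : absoluteGaloisGroup K, e (absGaloisRestrict ℚ K τ • P) = τ • e P :=
    fun τ ↦ primaryBaseChangeEquiv_smul K W p τ P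
  have hPfix : ∀ τ ∈ κ.kerSubgroup, absGaloisRestrict ℚ K τ • (P : geomPoints W) = P := by
    intro τ hτ
    have h1 : e (absGaloisRestrict ℚ K τ • P) = e P := by
      rw [hequiv, ← hmP]
      have h := (FixedPoints.mem_addSubgroup _ _ _).mp hm ⟨τ, hτ⟩
      rwa [Subgroup.mk_smul] at h
    have h2 := congrArg (fun z : geomPrimaryTorsion W p ↦ (z : geomPoints W)) (e.injective h1)
    simpa only [primaryComponent.coe_smul] using h2
  have hPprim : ∃ n : ℕ, p ^ n • (P : geomPoints W) = 0 :=
    (AddCommGroup.mem_primaryComponent).mp P.2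
  have key := absGaloisRestrict_smul_eq_of_forall_kerSubgroup_smul_eq W κ hp2 hK hζ hκ hPprim
    hPfix σ
  have hσP : absGaloisRestrict ℚ K σ • P = P :=
    Subtype.ext (by rw [primaryComponent.coe_smul]; exact key)
  rw [hmP, ← hequiv, hσP]

/-- `E(K_∞^{ac})[p^∞] = E(K)[p^∞]` as an equality of fixed-point sets: a point of `E_K[p^∞]` is
fixed by `Gal(K̄/K_∞^{ac})` iff it is fixed by `Γ_K` (`p` odd, `K` imaginary quadratic with
`μ_p(K) = 1`, `κ` anticyclotomic). [folklore] -/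
theorem mem_fixedPoints_kerSubgroup_iff_of_isAnticyclotomic (hp2 : p ≠ 2)
    (hK : IsImaginaryQuadratic K) (hζ : ∀ z : K, z ^ p = 1 → z = 1) (hκ : κ.IsAnticyclotomic)
    (m : geomPrimaryTorsion (W.baseChange K) p) :
    m ∈ FixedPoints.addSubgroup κ.kerSubgroup (geomPrimaryTorsion (W.baseChange K) p) ↔
      ∀ σ : absoluteGaloisGroup K, σ • m = m :=
  ⟨fun hm σ ↦ smul_eq_of_mem_fixedPoints_kerSubgroup_of_isAnticyclotomic W p κ hp2 hK hζ hκ hm σ,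
    fun h ↦ (FixedPoints.mem_addSubgroup _ _ _).mpr fun τ ↦ by rw [Subgroup.smul_def]; exact h τ⟩

/-- **`B = E(K_∞^{ac})[p^∞]` is finite** (`p` odd, `K` imaginary quadratic with `μ_p(K) = 1`,
`κ` anticyclotomic, any `E/ℚ`): it equals `E(K)[p^∞]`, and the `Γ_K`-fixed points of `E_K[p^∞]`
are finitely many (`finite_fixedPoints_geomPrimaryTorsion`). This is the hypothesis `[Finite B]`
of Greenberg's Lemma 4.3 / Theorem 4.1 counts in the tree and of the (KER-res) identification
`natCard_ker_resOfLe_top_eq_natCard_fixedPoints`. [cite: GreenbergLNM1716, §1 p. 62; §3 p. 86] -/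
theorem finite_fixedPoints_kerSubgroup_of_isAnticyclotomic (hp2 : p ≠ 2)
    (hK : IsImaginaryQuadratic K) (hζ : ∀ z : K, z ^ p = 1 → z = 1) (hκ : κ.IsAnticyclotomic) :
    Finite (FixedPoints.addSubgroup κ.kerSubgroup (geomPrimaryTorsion (W.baseChange K) p)) := by
  have hfin := (W.baseChange K).finite_fixedPoints_geomPrimaryTorsion p
  have hsub : ((FixedPoints.addSubgroup κ.kerSubgroup (geomPrimaryTorsion (W.baseChange K) p) :
      AddSubgroup (geomPrimaryTorsion (W.baseChange K) p)) :
        Set (geomPrimaryTorsion (W.baseChange K) p)) ⊆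
      {m | ∀ σ : absoluteGaloisGroup K, σ • m = m} := fun m hm ↦
    (mem_fixedPoints_kerSubgroup_iff_of_isAnticyclotomic W p κ hp2 hK hζ hκ m).mp hm
  exact (hfin.subset hsub).to_subtype

/-- `#E(K_∞^{ac})[p^∞] = #E(K)[p^∞]`: the fixed points of `ker κ` and of `Γ_K` on `E_K[p^∞]`
coincide. [folklore] -/
theorem natCard_fixedPoints_kerSubgroup_eq_of_isAnticyclotomic (hp2 : p ≠ 2)
    (hK : IsImaginaryQuadratic K) (hζ : ∀ z : K, z ^ p = 1 → z = 1) (hκ : κ.IsAnticyclotomic) :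
    Nat.card (FixedPoints.addSubgroup κ.kerSubgroup (geomPrimaryTorsion (W.baseChange K) p)) =
      Nat.card {m : geomPrimaryTorsion (W.baseChange K) p |
        ∀ σ : absoluteGaloisGroup K, σ • m = m} :=
  Nat.card_congr (Equiv.subtypeEquivRight fun m ↦
    mem_fixedPoints_kerSubgroup_iff_of_isAnticyclotomic W p κ hp2 hK hζ hκ m)

/-- The same finiteness under `p ∤ #μ(K)` (the route's `¬ p ∣ torsionOrder K`). [folklore] -/
theorem finite_fixedPoints_kerSubgroup_of_not_dvd_torsionOrder (hp2 : p ≠ 2)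
    (hK : IsImaginaryQuadratic K) (hpK : ¬ p ∣ NumberField.Units.torsionOrder K)
    (hκ : κ.IsAnticyclotomic) :
    Finite (FixedPoints.addSubgroup κ.kerSubgroup (geomPrimaryTorsion (W.baseChange K) p)) :=
  finite_fixedPoints_kerSubgroup_of_isAnticyclotomic W p κ hp2 hK
    (eq_one_of_pow_prime_eq_one_of_not_dvd_torsionOrder p hpK) hκ

end OverK

end Summit.BirchSwinnertonDyer.BirchSwinnertonDyer.Theorems.SchneiderFreeAdditiveX3

end
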